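import Mathlib
import HarnessLib

/-!
# The implicit function theorem for one scalar equation in two scalar unknowns

Topic `Literature/Analysis/Calculus` (namespace `Literature.Analysis.Calculus`). The elementary
case of the implicit function theorem used by shooting / eigenvalue-curve arguments: for
`f : 𝕜 × 𝕜 → 𝕜` (`𝕜 = ℝ` or `ℂ`) of class `Cⁿ`, `n ≥ 1`, near a zero `p = (x₀, y₀)` with
`∂f/∂x (p) ≠ 0`, there is a `Cⁿ` function `g` near `y₀` with `g(y₀) = x₀`, `f(g(y), y) = 0` near
`y₀`, every zero of `f` near `p` lies on the graph of `g`, and `g'(y₀) = −(∂f/∂y)/(∂f/∂x)(p)`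
(`exists_implicit_of_partial_ne_zero`). Over `ℂ` this is the holomorphic implicit function theorem
in one variable ("we embed the eigenvalues into holomorphic curves", Shlapentokh-Rothman, CMP 329
(2014), App. B). Proof: Mathlib's inverse function theorem (`ContDiffAt.localInverse`,
`HasStrictFDerivAt.eventually_right_inverse/left_inverse`) for `Ψ(x, y) = (f(x, y), y)`, whose
derivative `(u, v) ↦ (∂ₓf u + ∂_yf v, v)` is invertible exactly when `∂ₓf ≠ 0`. Everything is proved.

## References

* S. Lang, *Real and Functional Analysis* / any calculus text: the implicit function theorem from
  the inverse function theorem. [folklore]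
* Y. Shlapentokh-Rothman, Comm. Math. Phys. 329 (2014) 859–891, App. B. Key
  `ShlapentokhRothman2014KleinGordon`.
-/

noncomputable section

open Set Filter Topology

namespace Literature.Analysis.Calculus

variable {𝕜 : Type*} [RCLike 𝕜]

/-- The partial derivatives of a `C¹` map `f : 𝕜 × 𝕜 → 𝕜` determine its Fréchet derivative:
`Df(p)(u, v) = ∂ₓf · u + ∂_yf · v`. [folklore] -/
theorem hasFDerivAt_of_partials {f : 𝕜 × 𝕜 → 𝕜} {p : 𝕜 × 𝕜} {n : WithTop ℕ∞} (hf : ContDiffAt 𝕜 n f p)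
    (hn : 1 ≤ n) {d c : 𝕜} (hx : HasDerivAt (fun x ↦ f (x, p.2)) d p.1) (hy : HasDerivAt (fun y ↦ f (p.1, y)) c p.2) :
    HasFDerivAt f (d • ContinuousLinearMap.fst 𝕜 𝕜 𝕜 + c • ContinuousLinearMap.snd 𝕜 𝕜 𝕜) p := by
  have hD : HasFDerivAt f (fderiv 𝕜 f p) p := (hf.differentiableAt (by positivity)).hasFDerivAt
  -- identify the derivative on the two axes
  have h1 : fderiv 𝕜 f p (1, 0) = d := by
    have hl : HasDerivAt (fun x : 𝕜 ↦ (x, p.2)) ((1 : 𝕜), (0 : 𝕜)) p.1 := (hasDerivAt_id p.1).prodMk (hasDerivAt_const _ _)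
    have h := hD.comp_hasDerivAt p.1 (f := fun x : 𝕜 ↦ (x, p.2)) (by simpa using hl)
    calc fderiv 𝕜 f p (1, 0) = deriv (f ∘ fun x : 𝕜 ↦ (x, p.2)) p.1 := h.deriv.symm
      _ = deriv (fun x : 𝕜 ↦ f (x, p.2)) p.1 := rfl
      _ = d := hx.deriv
  have h2 : fderiv 𝕜 f p (0, 1) = c := by
    have hl : HasDerivAt (fun y : 𝕜 ↦ (p.1, y)) ((0 : 𝕜), (1 : 𝕜)) p.2 := (hasDerivAt_const _ _).prodMk (hasDerivAt_id p.2)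
    have h := hD.comp_hasDerivAt p.2 (f := fun y : 𝕜 ↦ (p.1, y)) (by simpa using hl)
    calc fderiv 𝕜 f p (0, 1) = deriv (f ∘ fun y : 𝕜 ↦ (p.1, y)) p.2 := h.deriv.symm
      _ = deriv (fun y : 𝕜 ↦ f (p.1, y)) p.2 := rfl
      _ = c := hy.deriv
  have hL : fderiv 𝕜 f p = d • ContinuousLinearMap.fst 𝕜 𝕜 𝕜 + c • ContinuousLinearMap.snd 𝕜 𝕜 𝕜 := by
    refine ContinuousLinearMap.ext fun q ↦ ?_
    obtain ⟨u, v⟩ := q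
    rw [show ((d • ContinuousLinearMap.fst 𝕜 𝕜 𝕜 + c • ContinuousLinearMap.snd 𝕜 𝕜 𝕜) (u, v)) = d * u + c * v by
      simp [smul_eq_mul]]
    have hu : ((u, v) : 𝕜 × 𝕜) = u • ((1 : 𝕜), (0 : 𝕜)) + v • ((0 : 𝕜), (1 : 𝕜)) := by ext <;> simp
    rw [hu, map_add, map_smul, map_smul, h1, h2, smul_eq_mul, smul_eq_mul]
    ring
  rw [← hL]
  exact hD

/-- **The implicit function theorem for one scalar equation.** Let `f : 𝕜 × 𝕜 → 𝕜` be `Cⁿ` at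
`p = (x₀, y₀)` (`1 ≤ n`), `f(p) = 0`, with partial derivatives `∂ₓf(p) = d ≠ 0`, `∂_yf(p) = c`.
Then there is `g : 𝕜 → 𝕜`, `Cⁿ` at `y₀`, with `g(y₀) = x₀`, `f(g(y), y) = 0` for `y` near `y₀`,
`g'(y₀) = −c/d`, and LOCAL UNIQUENESS: every zero `q` of `f` near `p` satisfies `q.1 = g(q.2)`.
(For `𝕜 = ℂ`, `g` is holomorphic near `y₀`.) [folklore] -/
theorem exists_implicit_of_partial_ne_zero {f : 𝕜 × 𝕜 → 𝕜} {p : 𝕜 × 𝕜} {n : WithTop ℕ∞}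
    (hf : ContDiffAt 𝕜 n f p) (hn : 1 ≤ n) {d c : 𝕜}
    (hx : HasDerivAt (fun x ↦ f (x, p.2)) d p.1) (hy : HasDerivAt (fun y ↦ f (p.1, y)) c p.2)
    (hd : d ≠ 0) (h0 : f p = 0) :
    ∃ g : 𝕜 → 𝕜, g p.2 = p.1 ∧ ContDiffAt 𝕜 n g p.2 ∧ (∀ᶠ y in 𝓝 p.2, f (g y, y) = 0) ∧
      (∀ᶠ q in 𝓝 p, f q = 0 → q.1 = g q.2) ∧ HasDerivAt g (-c / d) p.2 := by
  have hn0 : n ≠ 0 := by positivity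
  -- the derivative of `f` and of `Ψ = (f, snd)`
  set L : 𝕜 × 𝕜 →L[𝕜] 𝕜 := d • ContinuousLinearMap.fst 𝕜 𝕜 𝕜 + c • ContinuousLinearMap.snd 𝕜 𝕜 𝕜 with hL
  have hfL : HasFDerivAt f L p := hasFDerivAt_of_partials hf hn hx hy
  set Ψ : 𝕜 × 𝕜 → 𝕜 × 𝕜 := fun q ↦ (f q, q.2) with hΨ
  set Ψ' : 𝕜 × 𝕜 →L[𝕜] 𝕜 × 𝕜 := L.prod (ContinuousLinearMap.snd 𝕜 𝕜 𝕜) with hΨ'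
  set M : 𝕜 × 𝕜 →L[𝕜] 𝕜 × 𝕜 :=
    (d⁻¹ • ContinuousLinearMap.fst 𝕜 𝕜 𝕜 - (c / d) • ContinuousLinearMap.snd 𝕜 𝕜 𝕜).prod
      (ContinuousLinearMap.snd 𝕜 𝕜 𝕜) with hM
  have hΨ'_apply : ∀ q : 𝕜 × 𝕜, Ψ' q = (d * q.1 + c * q.2, q.2) := fun q ↦ by
    simp [hΨ', hL]
  have hM_apply : ∀ q : 𝕜 × 𝕜, M q = (d⁻¹ * q.1 - c / d * q.2, q.2) := fun q ↦ by
    simp [hM, sub_eq_add_neg]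
  have hleft : Function.LeftInverse M Ψ' := fun q ↦ by
    rw [hΨ'_apply, hM_apply]
    ext
    · simp only
      field_simp
      ring
    · rfl
  have hright : Function.RightInverse M Ψ' := fun q ↦ by
    rw [hM_apply, hΨ'_apply]
    ext
    · simp only
      field_simp
      ring
    · rfl
  set Φ : (𝕜 × 𝕜) ≃L[𝕜] (𝕜 × 𝕜) := ContinuousLinearEquiv.equivOfInverse Ψ' M hleft hright with hΦ
  have hΨc : ContDiffAt 𝕜 n Ψ p := hf.prodMk contDiffAt_snd
  have hΨd : HasFDerivAt Ψ (Φ : 𝕜 × 𝕜 →L[𝕜] 𝕜 × 𝕜) p := by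
    have h : HasFDerivAt Ψ Ψ' p := hfL.prodMk (hasFDerivAt_snd (𝕜 := 𝕜) (E := 𝕜) (F := 𝕜))
    exact h
  have hs : HasStrictFDerivAt Ψ (Φ : 𝕜 × 𝕜 →L[𝕜] 𝕜 × 𝕜) p := hΨc.hasStrictFDerivAt' hΨd hn0
  -- the local inverse
  set inv := hs.localInverse Ψ Φ p with hinv
  have hΨp : Ψ p = (0, p.2) := by simp [hΨ, h0]
  set g : 𝕜 → 𝕜 := fun y ↦ (inv (0, y)).1 with hg
  have hemb : Continuous fun y : 𝕜 ↦ ((0 : 𝕜), y) := continuous_const.prodMk continuous_id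
  have hemb_at : Tendsto (fun y : 𝕜 ↦ ((0 : 𝕜), y)) (𝓝 p.2) (𝓝 (Ψ p)) := by
    rw [hΨp]; exact hemb.continuousAt
  -- right inverse near `Ψ p`
  have hright_inv : ∀ᶠ y in 𝓝 p.2, Ψ (inv (0, y)) = (0, y) := hemb_at.eventually hs.eventually_right_inverse
  have hzero : ∀ᶠ y in 𝓝 p.2, f (g y, y) = 0 := by
    filter_upwards [hright_inv] with y hy
    have h2 : (inv (0, y)).2 = y := by
      have := congrArg Prod.snd hy
      simpa [hΨ] using this
    have h1 : f (inv (0, y)) = 0 := by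
      have := congrArg Prod.fst hy
      simpa [hΨ] using this
    have hpair : inv (0, y) = (g y, y) := Prod.ext rfl h2
    rw [← hpair]
    exact h1
  refine ⟨g, ?_, ?_, hzero, ?_, ?_⟩
  · -- `g y₀ = x₀`
    simp only [hg]
    rw [← hΨp, hinv, hs.localInverse_apply_image]
  · -- smoothness
    have hinvC : ContDiffAt 𝕜 n inv (Ψ p) := hΨc.to_localInverse hΨd hn0
    rw [hΨp] at hinvC
    exact contDiffAt_fst.comp p.2 (hinvC.comp p.2 (contDiffAt_const.prodMk contDiffAt_id))
  · -- local uniqueness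
    filter_upwards [hs.eventually_left_inverse] with q hq hfq
    have hΨq : Ψ q = (0, q.2) := by simp [hΨ, hfq]
    rw [hΨq] at hq
    simp only [hg]
    rw [hinv, hq]
  · -- the derivative `g'(y₀) = -c/d`
    have hinvD : HasFDerivAt inv (Φ.symm : 𝕜 × 𝕜 →L[𝕜] 𝕜 × 𝕜) (Ψ p) := hs.to_localInverse.hasFDerivAt
    rw [hΨp] at hinvD
    have hl : HasDerivAt (fun y : 𝕜 ↦ ((0 : 𝕜), y)) ((0 : 𝕜), (1 : 𝕜)) p.2 := (hasDerivAt_const _ _).prodMk (hasDerivAt_id p.2)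
    have hcomp : HasDerivAt (fun y : 𝕜 ↦ inv (0, y)) ((Φ.symm : 𝕜 × 𝕜 →L[𝕜] 𝕜 × 𝕜) ((0 : 𝕜), (1 : 𝕜))) p.2 :=
      hinvD.comp_hasDerivAt p.2 hl
    have hfst := ((ContinuousLinearMap.fst 𝕜 𝕜 𝕜).hasFDerivAt).comp_hasDerivAt p.2 hcomp
    have hval : (ContinuousLinearMap.fst 𝕜 𝕜 𝕜) ((Φ.symm : 𝕜 × 𝕜 →L[𝕜] 𝕜 × 𝕜) ((0 : 𝕜), (1 : 𝕜))) = -c / d := by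
      have : (Φ.symm : 𝕜 × 𝕜 →L[𝕜] 𝕜 × 𝕜) ((0 : 𝕜), (1 : 𝕜)) = M ((0 : 𝕜), (1 : 𝕜)) := rfl
      rw [this, hM_apply]
      simp
      ring
    rw [hval] at hfst
    exact hfst

end Literature.Analysis.Calculus

end
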